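import Literature.Analysis.ODE.ParametricLinear
import Literature.MathematicalPhysics.QuantumLattice.YangMillsClassical
import Mathlib.Analysis.Calculus.MeanValue
import HarnessLib

/-!
# Parallel transport along segments and the exponential (Fock–Schwinger) gauge

QuantumLattice support file (everything proved; two definitions with bodies, no named facts) on
the proof path of `Literature.MathematicalPhysics.QuantumLattice.Waldron2019_yangMillsFlow_flatTorus`
(A. Waldron, Invent. math. 217 (2019)), Lemma 3.5 / §4: the covariant eigenvalue estimates on
spheres are perturbations of the flat ones in a gauge where the connection is small, `|Ã| ≲ |F|`;
such a gauge is the exponential gauge centred at a point `c`, i.e. parallel transport along the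
segments `τ ↦ c + τ(x − c)`. For a `C^n` connection `A` on a Banach space `E` with values in a
Banach algebra `𝔸` we construct, from the tree's parametric linear ODE theorem
(`Literature.Analysis.ODE.exists_contDiffOn_linearODE_param`, Lang 1995 IV §1), the transport

* `segPT c A : E → ℝ → 𝔸` — `∂_τ segPT c A x τ = −A(c + τ(x−c))(x−c) · segPT c A x τ`,
  `segPT c A x 0 = 1`, jointly `C^n` on `E × (−3/2, 3/2)` (`hasDerivAt_segPT`, `segPT_zero`,
  `contDiffOn_segPT`);
* `expGauge c A x = segPT c A x 1` — the exponential gauge transformation, `C^n` in `x`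
  (`contDiffOn_expGauge`), `expGauge c A c = 1`;
* `segPT_rescale` — `segPT c A (c + s(x−c)) τ = segPT c A x (s τ)` (uniqueness), whence
  `expGauge c A (c + s(x − c)) = segPT c A x s` and the **radial transport equation**
  `D(expGauge)(x)(x − c) = −A(x)(x − c) · expGauge(x)` (`fderiv_expGauge_radial`);
* `segPT_mul_segPTInv`, `isUnit_expGauge` — invertibility (the transport of `u ↦ u A` is a
  two-sided inverse).

References: A. Waldron, Invent. math. 217 (2019), §3–§4 [Waldron2019]; S. Lang, *Differential
and Riemannian Manifolds* (1995), IV §1 [folklore]; (exponential gauge) K. Uhlenbeck, Comm. Math.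
Phys. 83 (1982), §2 [folklore].
-/

noncomputable section

open Set Metric Filter
open scoped Topology

namespace Literature.MathematicalPhysics.QuantumLattice

universe u

section SegPT

variable {E : Type u} [NormedAddCommGroup E] [InnerProductSpace ℝ E] [CompleteSpace E]
variable {𝔸 : Type u} [NormedRing 𝔸] [NormedAlgebra ℝ 𝔸] [CompleteSpace 𝔸]

/-- The coefficient of the transport equation along the segment from `c` to `x`:
`u ↦ −A(c + τ(x − c))(x − c) · u`. [folklore] -/
def segCoeff (c : E) (A : Connection E 𝔸) (x : E) (τ : ℝ) : 𝔸 →L[ℝ] 𝔸 :=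
  -(ContinuousLinearMap.mul ℝ 𝔸 (A (c + τ • (x - c)) (x - c)))

omit [CompleteSpace E] [CompleteSpace 𝔸] in
/-- Unfolding lemma. [folklore] -/
@[simp] theorem segCoeff_apply (c : E) (A : Connection E 𝔸) (x : E) (τ : ℝ) (u : 𝔸) :
    segCoeff c A x τ u = -(A (c + τ • (x - c)) (x - c) * u) := by
  simp only [segCoeff, neg_apply, ContinuousLinearMap.mul_apply']

omit [CompleteSpace E] [CompleteSpace 𝔸] in
/-- Joint smoothness of the coefficient for a `C^n` connection. [folklore] -/
theorem contDiff_segCoeff {n : WithTop ℕ∞} {A : Connection E 𝔸} (hA : ContDiff ℝ n A) (c : E) :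
    ContDiff ℝ n (fun q : E × ℝ => segCoeff c A q.1 q.2) := by
  unfold segCoeff
  have h1 : ContDiff ℝ n (fun q : E × ℝ => c + q.2 • (q.1 - c)) :=
    contDiff_const.add (contDiff_snd.smul (contDiff_fst.sub contDiff_const))
  have h2 : ContDiff ℝ n (fun q : E × ℝ => A (c + q.2 • (q.1 - c)) (q.1 - c)) :=
    (hA.comp h1).clm_apply (contDiff_fst.sub contDiff_const)
  exact ((ContinuousLinearMap.mul ℝ 𝔸).contDiff.comp h2).neg

/-- The existence package behind `segPT` (Lang's parametric linear flow, time interval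
`(−3/2, 3/2) ⊂ (−2, 2)`, initial value `1`). [folklore] -/
theorem exists_segPT {n : ℕ∞} (hn : 1 ≤ n) {A : Connection E 𝔸} (hA : ContDiff ℝ n A) (c : E) :
    ∃ u : E → ℝ → 𝔸, (∀ x, u x 0 = 1) ∧
      (∀ x, ∀ τ ∈ Ioo (-(3/2 : ℝ)) (3/2), HasDerivAt (u x) (segCoeff c A x τ (u x τ)) τ) ∧
      ContDiffOn ℝ n (fun q : E × ℝ => u q.1 q.2) (univ ×ˢ Ioo (-(3/2 : ℝ)) (3/2)) := by
  have hcoef : ContDiffOn ℝ n (fun q : E × ℝ => segCoeff c A q.1 q.2) (univ ×ˢ Ioo (-(2 : ℝ)) 2) :=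
    (contDiff_segCoeff (hA.of_le (by exact_mod_cast le_rfl)) c).contDiffOn
  obtain ⟨u, h0, hd, hs⟩ := Literature.Analysis.ODE.exists_contDiffOn_linearODE_param hn isOpen_univ
    (by norm_num : (0 : ℝ) < 3 / 2) (by norm_num : (3 / 2 : ℝ) < 2) hcoef (1 : 𝔸)
  exact ⟨u, fun x => h0 x (mem_univ _), fun x τ hτ => hd x (mem_univ _) τ hτ, hs⟩

/-- **Parallel transport along segments from `c`**: for a `C¹` connection, a choice of the
solution family of `exists_segPT` (only its characterizing properties below are used; by
uniqueness any other solution family agrees with it); the constant `1` otherwise. [folklore] -/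
def segPT (c : E) (A : Connection E 𝔸) : E → ℝ → 𝔸 := by
  classical
  exact if hA : ContDiff ℝ 1 A then Classical.choose (exists_segPT le_rfl hA c) else fun _ _ => 1

/-- Unfolding lemma (the `C¹` branch). [folklore] -/
theorem segPT_def {A : Connection E 𝔸} (hA : ContDiff ℝ 1 A) (c : E) :
    segPT c A = Classical.choose (exists_segPT le_rfl hA c) := by
  unfold segPT
  rw [dif_pos hA]

/-- Initial value `segPT c A x 0 = 1`. [folklore] -/
theorem segPT_zero {A : Connection E 𝔸} (hA : ContDiff ℝ 1 A) (c x : E) : segPT c A x 0 = 1 := by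
  rw [segPT_def hA]
  exact (Classical.choose_spec (exists_segPT le_rfl hA c)).1 x

/-- **The transport equation** `∂_τ segPT c A x τ = −A(c + τ(x−c))(x−c) · segPT c A x τ` on
`(−3/2, 3/2)`. [folklore] -/
theorem hasDerivAt_segPT {A : Connection E 𝔸} (hA : ContDiff ℝ 1 A) (c x : E) {τ : ℝ}
    (hτ : τ ∈ Ioo (-(3/2 : ℝ)) (3/2)) :
    HasDerivAt (segPT c A x) (-(A (c + τ • (x - c)) (x - c) * segPT c A x τ)) τ := by
  rw [segPT_def hA]
  have h := (Classical.choose_spec (exists_segPT le_rfl hA c)).2.1 x τ hτ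
  simpa using h

omit [CompleteSpace E] [CompleteSpace 𝔸] in
/-- The coefficient is continuous in `τ`. [folklore] -/
theorem continuous_segCoeff {A : Connection E 𝔸} (hA : ContDiff ℝ 1 A) (c x : E) :
    Continuous (segCoeff c A x) :=
  ((contDiff_segCoeff hA c).continuous).comp (continuous_const.prodMk continuous_id)

/-- **Uniqueness**: any solution of the transport equation on `(−3/2, 3/2)` with value `1` at `0`
is `segPT`. [folklore] -/
theorem eq_segPT_of_hasDerivAt {A : Connection E 𝔸} (hA : ContDiff ℝ 1 A) (c x : E) {v : ℝ → 𝔸}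
    (hv0 : v 0 = 1)
    (hv : ∀ τ ∈ Ioo (-(3/2 : ℝ)) (3/2), HasDerivAt v (-(A (c + τ • (x - c)) (x - c) * v τ)) τ) :
    EqOn v (segPT c A x) (Ioo (-(3/2 : ℝ)) (3/2)) := by
  refine Literature.Analysis.ODE.eqOn_of_hasDerivAt_linear (B := segCoeff c A x)
    (t₀ := 0) (by norm_num) (continuous_segCoeff hA c x).continuousOn (fun τ hτ => ?_)
    (fun τ hτ => ?_) (by rw [hv0, segPT_zero hA])
  · simpa using hv τ hτ
  · simpa using hasDerivAt_segPT hA c x hτ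

/-- **Joint smoothness**: for a `C^n` connection (`n ≥ 1`), `(x, τ) ↦ segPT c A x τ` is `C^n` on
`E × (−3/2, 3/2)`. [folklore] -/
theorem contDiffOn_segPT {n : ℕ∞} (hn : 1 ≤ n) {A : Connection E 𝔸} (hA : ContDiff ℝ n A) (c : E) :
    ContDiffOn ℝ n (fun q : E × ℝ => segPT c A q.1 q.2) (univ ×ˢ Ioo (-(3/2 : ℝ)) (3/2)) := by
  have hA1 : ContDiff ℝ 1 A := hA.of_le (by exact_mod_cast hn)
  obtain ⟨u, h0, hd, hs⟩ := exists_segPT hn hA c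
  refine hs.congr fun q hq => ?_
  have hq2 : q.2 ∈ Ioo (-(3/2 : ℝ)) (3/2) := hq.2
  have heq := eq_segPT_of_hasDerivAt hA1 c q.1 (h0 q.1) (fun τ hτ => by simpa using hd q.1 τ hτ)
  exact (heq hq2).symm

/-- At the centre nothing moves: `segPT c A c τ = 1`. [folklore] -/
theorem segPT_center {A : Connection E 𝔸} (hA : ContDiff ℝ 1 A) (c : E) {τ : ℝ}
    (hτ : τ ∈ Ioo (-(3/2 : ℝ)) (3/2)) : segPT c A c τ = 1 := by
  have h := eq_segPT_of_hasDerivAt hA c c (v := fun _ => (1 : 𝔸)) rfl (fun τ _ => by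
    simpa using hasDerivAt_const τ (1 : 𝔸))
  exact (h hτ).symm

/-- **Rescaling along the ray** (uniqueness): `segPT c A (c + s(x−c)) τ = segPT c A x (s τ)` for
`0 ≤ s ≤ 1`, `τ ∈ (−3/2, 3/2)`. [folklore] -/
theorem segPT_rescale {A : Connection E 𝔸} (hA : ContDiff ℝ 1 A) (c x : E) {s : ℝ} (hs0 : 0 ≤ s)
    (hs1 : s ≤ 1) {τ : ℝ} (hτ : τ ∈ Ioo (-(3/2 : ℝ)) (3/2)) :
    segPT c A (c + s • (x - c)) τ = segPT c A x (s * τ) := by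
  -- `v(τ) = segPT c A x (s τ)` solves the transport equation of the endpoint `c + s(x − c)`
  have hv : ∀ σ ∈ Ioo (-(3/2 : ℝ)) (3/2), HasDerivAt (fun σ => segPT c A x (s * σ))
      (-(A (c + σ • (c + s • (x - c) - c)) (c + s • (x - c) - c) * segPT c A x (s * σ))) σ := by
    intro σ hσ
    have hsσ : s * σ ∈ Ioo (-(3/2 : ℝ)) (3/2) := by
      constructor <;> nlinarith [hσ.1, hσ.2]
    have h1 := (hasDerivAt_segPT hA c x hsσ).scomp σ ((hasDerivAt_id σ).const_mul s)
    have heq : c + σ • (c + s • (x - c) - c) = c + (s * σ) • (x - c) := by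
      rw [add_sub_cancel_left, smul_smul, mul_comm]
    rw [heq, add_sub_cancel_left, map_smul]
    simp only [mul_one] at h1
    have h2 : HasDerivAt (fun σ => segPT c A x (s * σ))
        (s • -(A (c + (s * σ) • (x - c)) (x - c) * segPT c A x (s * σ))) σ := h1
    refine h2.congr_deriv ?_
    rw [smul_neg, smul_mul_assoc]
  have h := eq_segPT_of_hasDerivAt hA c (c + s • (x - c)) (v := fun σ => segPT c A x (s * σ))
    (by simp [segPT_zero hA]) hv
  exact (h hτ).symm

/-! ### The exponential gauge -/

/-- **The exponential (Fock–Schwinger) gauge transformation centred at `c`**: parallel transport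
from `c` to `x` along the segment. [folklore] -/
def expGauge (c : E) (A : Connection E 𝔸) (x : E) : 𝔸 := segPT c A x 1

/-- `1 ∈ (−3/2, 3/2)`. [folklore] -/
theorem one_mem_Ioo32 : (1 : ℝ) ∈ Ioo (-(3/2 : ℝ)) (3/2) := by constructor <;> norm_num

/-- `expGauge c A c = 1`. [folklore] -/
theorem expGauge_center {A : Connection E 𝔸} (hA : ContDiff ℝ 1 A) (c : E) : expGauge c A c = 1 :=
  segPT_center hA c one_mem_Ioo32

/-- **Smoothness of the exponential gauge**: `C^n` for a `C^n` connection (`n ≥ 1`). [folklore] -/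
theorem contDiff_expGauge {n : ℕ∞} (hn : 1 ≤ n) {A : Connection E 𝔸} (hA : ContDiff ℝ n A) (c : E) :
    ContDiff ℝ n (expGauge c A) := by
  have h := contDiffOn_segPT hn hA c
  have h2 : ContDiff ℝ n (fun x : E => ((x, (1 : ℝ)) : E × ℝ)) := contDiff_id.prodMk contDiff_const
  have h3 := h.comp_contDiff h2 (fun x => ⟨mem_univ _, one_mem_Ioo32⟩)
  exact h3

/-- **The gauge along rays**: `expGauge c A (c + s(x − c)) = segPT c A x s` for `0 ≤ s ≤ 1`.
[folklore] -/
theorem expGauge_ray {A : Connection E 𝔸} (hA : ContDiff ℝ 1 A) (c x : E) {s : ℝ} (hs0 : 0 ≤ s)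
    (hs1 : s ≤ 1) : expGauge c A (c + s • (x - c)) = segPT c A x s := by
  rw [expGauge, segPT_rescale hA c x hs0 hs1 one_mem_Ioo32, mul_one]

/-- **The radial transport equation of the exponential gauge**:
`D(expGauge)(x)(x − c) = −A(x)(x − c) · expGauge(x)`. [folklore] -/
theorem fderiv_expGauge_radial {A : Connection E 𝔸} (hA : ContDiff ℝ 1 A) (c x : E) :
    fderiv ℝ (expGauge c A) x (x - c) = -(A x (x - c) * expGauge c A x) := by
  -- compare along the ray of `x' = c + 2(x − c)` at the interior parameter `s = 1/2`
  set x' : E := c + (2 : ℝ) • (x - c) with hx'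
  have hxx' : c + (1/2 : ℝ) • (x' - c) = x := by
    rw [hx', add_sub_cancel_left, smul_smul]; norm_num
  have hx'c : x' - c = (2 : ℝ) • (x - c) := by rw [hx', add_sub_cancel_left]
  -- the two functions of `s` agree near `1/2`
  have hloc : ∀ᶠ s in 𝓝 (1/2 : ℝ), expGauge c A (c + s • (x' - c)) = segPT c A x' s := by
    have hmem : Ioo (0 : ℝ) 1 ∈ 𝓝 (1/2 : ℝ) := Ioo_mem_nhds (by norm_num) (by norm_num)
    filter_upwards [hmem] with s hs
    exact expGauge_ray hA c x' hs.1.le hs.2.le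
  -- derivative of the left-hand side by the chain rule
  have hg : DifferentiableAt ℝ (expGauge c A) x :=
    ((contDiff_expGauge le_rfl hA c).differentiable (by simp)) x
  have hγ : HasDerivAt (fun s : ℝ => c + s • (x' - c)) (x' - c) (1/2 : ℝ) := by
    have := ((hasDerivAt_id (1/2 : ℝ)).smul_const (x' - c)).const_add c
    simpa using this
  have hL : HasDerivAt (fun s : ℝ => expGauge c A (c + s • (x' - c)))
      (fderiv ℝ (expGauge c A) x (x' - c)) (1/2 : ℝ) := by
    have h := hg.hasFDerivAt
    rw [← hxx'] at h
    have h2 := h.comp_hasDerivAt (1/2 : ℝ) hγ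
    rw [hxx'] at h2
    exact h2
  -- derivative of the right-hand side by the transport equation
  have hhalf : (1/2 : ℝ) ∈ Ioo (-(3/2 : ℝ)) (3/2) := by constructor <;> norm_num
  have hR := hasDerivAt_segPT hA c x' hhalf
  rw [hxx'] at hR
  have hRval : segPT c A x' (1/2) = expGauge c A x := by
    rw [← expGauge_ray hA c x' (by norm_num) (by norm_num), hxx']
  rw [hRval] at hR
  -- uniqueness of derivatives of locally equal functions: `hL` transported to `segPT c A x'`
  have hL' : HasDerivAt (segPT c A x') (fderiv ℝ (expGauge c A) x (x' - c)) (1/2 : ℝ) :=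
    hL.congr_of_eventuallyEq (hloc.mono fun s hs => hs.symm)
  have heq := hL'.unique hR
  -- `x' − c = 2(x − c)`: divide by `2`
  rw [hx'c, map_smul, map_smul, smul_mul_assoc] at heq
  have h2 : (2 : ℝ) • fderiv ℝ (expGauge c A) x (x - c) = (2 : ℝ) • -(A x (x - c) * expGauge c A x) := by
    rw [heq, smul_neg]
  exact smul_right_injective 𝔸 (two_ne_zero) h2

/-! ### Invertibility -/

/-- **The transport is invertible**: `segPT c A x τ` is a unit for `τ ∈ (−3/2, 3/2)` (the
solution of `w' = w · A(γ)(γ')` is a two-sided inverse). [folklore] -/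
theorem isUnit_segPT {A : Connection E 𝔸} (hA : ContDiff ℝ 1 A) (c x : E) {τ : ℝ}
    (hτ : τ ∈ Ioo (-(3/2 : ℝ)) (3/2)) : IsUnit (segPT c A x τ) := by
  set a : ℝ → 𝔸 := fun σ => A (c + σ • (x - c)) (x - c) with ha
  have hac : Continuous a := by
    have h2 : Continuous fun σ : ℝ => A (c + σ • (x - c)) :=
      hA.continuous.comp (continuous_const.add (continuous_id.smul continuous_const))
    exact h2.clm_apply continuous_const
  -- the right transport `w' = w a`, `w(0) = 1`
  obtain ⟨w, hw0, hw⟩ := Literature.Analysis.ODE.exists_solution_linear_Ioo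
    (W := 𝔸) (B := fun σ => (ContinuousLinearMap.mul ℝ 𝔸).flip (a σ)) (S := 3/2) (by norm_num)
    (((ContinuousLinearMap.mul ℝ 𝔸).flip.continuous.comp hac).continuousOn) 0 (1 : 𝔸)
  have hw' : ∀ σ ∈ Ioo (-(3/2 : ℝ)) (3/2), HasDerivAt w (w σ * a σ) σ := fun σ hσ => by
    simpa using hw σ hσ
  have hu' : ∀ σ ∈ Ioo (-(3/2 : ℝ)) (3/2), HasDerivAt (segPT c A x) (-(a σ * segPT c A x σ)) σ :=
    fun σ hσ => hasDerivAt_segPT hA c x hσ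
  have hO : IsOpen (Ioo (-(3/2 : ℝ)) (3/2)) := isOpen_Ioo
  have h0mem : (0 : ℝ) ∈ Ioo (-(3/2 : ℝ)) (3/2) := by constructor <;> norm_num
  -- `w u = 1`: the derivative of the product vanishes
  have hwu : ∀ σ ∈ Ioo (-(3/2 : ℝ)) (3/2), w σ * segPT c A x σ = 1 := by
    have hd : ∀ σ ∈ Ioo (-(3/2 : ℝ)) (3/2), HasDerivAt (fun σ => w σ * segPT c A x σ) 0 σ := by
      intro σ hσ
      have h := (hw' σ hσ).mul (hu' σ hσ)
      have hzero : w σ * a σ * segPT c A x σ + w σ * -(a σ * segPT c A x σ) = 0 := by noncomm_ring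
      rwa [hzero] at h
    intro σ hσ
    have hconst := hO.is_const_of_deriv_eq_zero (convex_Ioo _ _).isPreconnected
      (fun σ hσ => (hd σ hσ).differentiableAt.differentiableWithinAt) (fun σ hσ => (hd σ hσ).deriv)
      hσ h0mem
    rw [hconst, hw0, segPT_zero hA, one_mul]
  -- `u w = 1`: `z = u w` and `1` solve the same linear equation `z' = −a z + z a`
  have huw : ∀ σ ∈ Ioo (-(3/2 : ℝ)) (3/2), segPT c A x σ * w σ = 1 := by
    set C : ℝ → 𝔸 →L[ℝ] 𝔸 := fun σ => -(ContinuousLinearMap.mul ℝ 𝔸 (a σ)) +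
      (ContinuousLinearMap.mul ℝ 𝔸).flip (a σ) with hC
    have hCc : ContinuousOn C (Ioo (-(3/2 : ℝ)) (3/2)) :=
      ((((ContinuousLinearMap.mul ℝ 𝔸).continuous.comp hac).neg).add
        ((ContinuousLinearMap.mul ℝ 𝔸).flip.continuous.comp hac)).continuousOn
    have h1 : ∀ σ ∈ Ioo (-(3/2 : ℝ)) (3/2), HasDerivAt (fun σ => segPT c A x σ * w σ)
        (C σ (segPT c A x σ * w σ)) σ := by
      intro σ hσ
      have h := (hu' σ hσ).mul (hw' σ hσ)
      refine h.congr_deriv ?_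
      simp only [hC, FunLike.coe_add, Pi.add_apply, neg_apply, ContinuousLinearMap.mul_apply',
        ContinuousLinearMap.flip_apply]
      noncomm_ring
    have h2 : ∀ σ ∈ Ioo (-(3/2 : ℝ)) (3/2), HasDerivAt (fun _ : ℝ => (1 : 𝔸)) (C σ 1) σ := by
      intro σ _
      have : C σ 1 = 0 := by
        simp only [hC, FunLike.coe_add, Pi.add_apply, neg_apply, ContinuousLinearMap.mul_apply',
          ContinuousLinearMap.flip_apply, mul_one, one_mul, neg_add_cancel]
      rw [this]; exact hasDerivAt_const σ (1 : 𝔸)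
    have heq := Literature.Analysis.ODE.eqOn_of_hasDerivAt_linear (B := C) (t₀ := 0) h0mem hCc
      h1 h2 (by simp [segPT_zero hA, hw0])
    exact fun σ hσ => heq hσ
  exact isUnit_iff_exists.2 ⟨w τ, huw τ hτ, hwu τ hτ⟩

/-- **The exponential gauge takes values in the units.** [folklore] -/
theorem isUnit_expGauge {A : Connection E 𝔸} (hA : ContDiff ℝ 1 A) (c x : E) :
    IsUnit (expGauge c A x) :=
  isUnit_segPT hA c x one_mem_Ioo32

end SegPT

end Literature.MathematicalPhysics.QuantumLattice

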